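import Literature.MathematicalPhysics.QuantumFieldTheory.Balaban1983to89.Node00.RepTowerOfRecord
import Literature.MathematicalPhysics.QuantumFieldTheory.Balaban1983to89.B14Sect3Decomp
import Literature.MathematicalPhysics.QuantumFieldTheory.Balaban1983to89.B14Eq316

/-!
# NODE 00 — ₇b/₉ (T-side), the `wOfRecord` HAND: the STEP WEIGHTS OF RECORD — print's labels `(P,Q,R,S)_{k+1}`,
# the index map (3.5) ∕ (3.20) into `𝐃_{k+1}` of record, the label weights from the PINNED decompositions of unity
# (3.2)·(3.3) [III] and a RESIDUAL fluctuation factor, and the unity ∕ size ∕ measurability provisos of the T-step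

Typing hand `pub-ymgap-dag-n02-b` on the CUT of the dedicated definer `pub-ymgap-node00-def-T` (₇b/₉ «T-STEP + REPRESENTED
TOWER»; brief `HOME/pub-ymgap-node00-def-T/READING-NOTE-W.md`, bus lines [NODE00-DEF-T-G0-READING-NOTE-2],
[DAGLEAD-G2-REBALANCE-34]).  [III] = [Balaban1988Convergent], [I] = [Balaban1987RG1].  Print: CMP **119** (1988) 243–285, §3
pp. 264–270, held `paper:doi-10-1007-bf01217741` (journal page = PDF page + 242).

WHAT THIS FILE IS.  FILE 1 `Node00.TStepOfRecord` types the k+1-st renormalization step (3.1) at the value level with a RESIDUAL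
datum `w : StepWeightsOfRecord` (the resummed factors of the decompositions of unity (3.2)·(3.3)·(3.5)·(3.16)·(3.20) attached to the
new pair `(Ω_{k+1}, Λ_{k+1})`) whose law `IsStepUnity` is displayed; FILE 2 `Node00.RepTowerOfRecord` §4 shows how a hand PINS `w`:
label types `Lb p g k`, an index map `σ` with `(σ s t).init = s`, label weights `ω`, and `stepWeightsOfResum` ∕ `isStepUnity_stepWeightsOfResum`.
This file supplies exactly that, AS PRINTED where print pins it and as an explicit residual where it does not:
* §1 the LAYER ALGEBRA of print on the torus of record over def-R's cube families (`Node00.SmallFieldChiOfRecord` §3): for a side `s`,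
  `hullD P s n X` = the union of the `s`-cubes within `n` layers of `X` (n = 0: *«the union of all LMR_{k+1}-cubes intersecting»*
  p. 264; n ≥ 1: *«we surround … by n layers»* p. 265), `innerD` (*«taking off one layer»* p. 268; [I] (2.10) `∼⁻ⁿ`),
  `fillD P s X` = the largest union of `s`-cubes inside `X`; every value is LITERALLY `⋃ a ∈ A, cubeEnl P s a 0` with
  `A ⊆ cubeIndices P s`, i.e. a member of def-R's `unionsOfCubes P s` (`hullD_mem_unionsOfCubes`, `fillD_mem_unionsOfCubes`).
* §2 the two cube families of step k+1 on the fine torus `Site (F.P p.K) 0`: the 𝐃_{k+1}-cubes (side `sideD` = def-R's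
  `dCubeSide … (k+1)`; print's *«LMR_{k+1}-cubes … belonging to the partition of the lattice T_η»* p. 264 = the class 𝐃_{k+1} of
  (2.1)) and the χ_{k+1}-cubes (side `sideχ` = def-R's `cubeSide … (k+1)`; print's *«cubes … of the size L²M₂R_{k+1}, or the
  partition of the lattice T_{L⁻¹η} into cubes of the size LM₂R_{k+1}»* (3.2) p. 265 — `L²M₂R_{k+1}·L^k = L^{k+2}M₂R_{k+1}` fine
  sites = EXACTLY def-R's (2.17) family one level up, so the front factor `chiSeqOfRecord … (k+1)` of (2.18) IS a sub-product of
  the (3.2) factors, as print says p. 267: *«The other characteristic functions introduced above are localized in Ω_{k+1}, and are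
  equal to χ_{k+1}(Ω_{k+1})χ′_k(Ω_{k+1})»*); the LABELS `LbOfRecord p g k` = quadruples `(P,Q,R,S)_{k+1}` of finite sets of
  χ_{k+1}-cube indices (ONE finite type per `(p,g,k)`; `Fintype` found by unification, none declared).
* §3 THE INDEX MAP `σOfRecord`: (3.5) p. 265 and (3.20) p. 269 as set expressions — `Z_k = Λ_kᶜ` ((2.3); at `k = 0` no large-field
  region), `Z̃_k^{∼4}`, the (3.2) window `(Z̃_k^{∼4})ᶜ`, `P′ = P̃`, **`B^{k+1}(P¹_{k+1}) = ((P′ ∪ Z̃^{∼4})^{∼1})ᶜ`** (p. 265 *«we surround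
  the union P′_{k+1} ∪ Z̃_k^{∼4} by a layer … Denote by P¹_{k+1} the subset … such that B^{k+1}(P¹_{k+1}) = (P′^∼_{k+1})ᶜ ∩ (Z̃_k^{∼5})ᶜ»*),
  the (3.3) range `(B^{k+1}(P¹_{k+1}))^{∼−1}`, **`Ω_{k+1} = ((Q̃_{k+1} ∪ (B^{k+1}(P¹_{k+1})ᶜ)^∼)^{∼2})ᶜ`** ((3.5), verbatim frame *«we
  surround the domain Q̃_{k+1} ∪ ((B^{k+1}(P¹_{k+1}))ᶜ)^∼ by two layers of such cubes. Denote Ω_{k+1} = (…)ᶜ (3.5)»*; the shape of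
  r11∕pv02's (1.10) `B14Sect1Sets.Omega1`), `Ω^{∼−1}_{k+1}` and the (3.16) range, `R̃_{k+1}`, **`Λ_{k+1} = (((Ω_{k+1}ᶜ)^∼ ∪ R̃_{k+1})^{∼1})ᶜ`**
  ((3.20) p. 269 *«The domain R̃_{k+1} is defined, as usual, as a union of the LMR_{k+1}-cubes intersecting R_{k+1}. We surround the
  domain (Ω_{k+1}ᶜ)^∼ ∪ R̃_{k+1} by a layer of LMR_{k+1}-cubes, and we denote the complement of the so-obtained domain by Λ_{k+1}»*).
  TYPING GUARDS (located, labelled): `Ω_{k+1}(t)` is intersected with `Λ_k ∩ (Z̃^{∼4})ᶜ ∩ (∪P)ᶜ` and filled with 𝐃_{k+1}-cubes, `Λ_{k+1}(t)`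
  with `Ω_{k+1}(t)` — NO-OPS in print, where the partitions nest (`Ω_{k+1} ⊆ B^{k+1}(P¹) ⊆ (Z̃^{∼5})ᶜ ∩ (P′^∼)ᶜ ⊆ Λ_k`), typed so that
  the admissibility `Λ_{k+1} ⊆ Ω_{k+1} ⊆ Λ_k` of (2.1) and the χ-bookkeeping below are kernel facts WITHOUT the numeric nesting side
  condition on `M, M₂, L` (node00-def's admissibility).  LOCATED SIMPLIFICATION (said): the p. 269 modification of `Λ_{k+1}` (*«if a
  component is contained in a cube of the size 100LMR_{k+1}, then we replace it by the smallest rectangular parallelepiped containing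
  it»*) is NOT applied; the label `S_{k+1}` does not move `(Ω_{k+1}, Λ_{k+1})` (p. 270: *«for a fixed domain Λ_{k+1}, as a sum over the
  admissible sets S_{k+1}»*).  Inadmissible labels carry weight `0` (§5), so their image is immaterial.
* §4 the (3.2)∕(3.3)∕(3.4) DATA of r11's `B14.Sect3Decomp.Sect3Data` PINNED at the record (a structure VALUE, not an instance): cubes =
  the χ_{k+1}-indices, `plaqT □′ = {p ⊂ □′^∼}`, `U_{k+1,□′}` = def-R's (2.16) `ukBox` one level up with def-R's (2.12) datum `bgOfRecord`,
  `(□′^{∼2})^{(k)*}` via r12's `B15DeterminingSets.embIter`, `(B^{k+1}(P¹))^{∼−1}` as `inB`; `δ_k = g_kA₁/(A₀p₀(g_k))` ((3.4); `A₁` of [I]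
  (1.16) is an explicit parameter — it is not a field of def-R's `Stage7Numerics`).
* §5 the LABEL WEIGHTS `ωOfRecord A₁ ζ`: `[P ⊆ (3.2)-range]·χ_{k+1}(Pᶜ)χᶜ_{k+1}(P) · [Q ⊆ (3.3)-range]·χ′_k(Qᶜ)χ′ᶜ_k(Q) · ζ(R,S)` with the
  (3.2)·(3.3) factors r11's `chiNext`∕`chiNextc`∕`chiPrime`∕`chiPrimec` on the pinned data, and `ζ` = the (3.16)·(3.20)·(3.21) fluctuation
  factor `ζ_{k+1}(R,S)` as an explicit RESIDUAL (`ZetaOfRecord`; its argument `V^{(k)} = M^k(U_{k+1})` is the sequence-dependent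
  minimiser of (3.10), `B14.Sect3Decomp.Claim310`, which has no body in the tree) with its two DISPLAYED laws `IsZetaUnity` (an instance
  of `B14.Eq316.eq316` for any fluctuation field) and `IsZetaAbsLeOne`.  The FRONT FACTOR is NOT divided out: by idempotency of the
  `{0,1}`-factors, `χ_{k+1}(σ s t) · χ_{k+1}((3.2)-range ∖ P) = χ_{k+1}((3.2)-range ∖ P)` (`front_absorb`).
* §6 THE OBLIGATIONS of FILE 2 §4: (O1) `init_σOfRecord` (n22-b's `Seq.init_snoc`); (O2) `labelUnity_ωOfRecord` — POINTWISE in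
  `(U, V')`: `Σ_t χ_{k+1}(σ s t)(V')·ω s t (U,V') = 1` (= `eq32` ∘ `eq33` ∘ the ζ-law), hence FILE 2's graph-side `χ_k`-weighted
  hypothesis; (O3) `sum_abs_ωOfRecord_le_one`; (O4) measurability is a DISPLAYED hypothesis (def-R's `bgOfRecord.U = UminOfRecord` is a
  classical-choice minimiser of (2.12); no measurable selection in the tree).
* §7 **`wOfRecord A₁ ζ := stepWeightsOfResum F N ν M LbOfRecord σOfRecord (ωOfRecord A₁ ζ)`** with `isStepUnity_wOfRecord`,
  `abs_wOfRecord_le_one`, `measurable_wOfRecord` — the provisos `unity` ∕ `absW_le` ∕ `measW` of FILE 2's `TStepProvisos` at the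
  weights of record, modulo the displayed ζ-laws and (O4).

HONEST SCOPE.  Definitions of record + kernel bookkeeping (`Finset.prod_add` via r11's `eq32`∕`eq33`, `Finset.sum_fiberwise` via FILE 2,
set algebra by `Finset.filter_subset`).  Nothing of Bałaban's is asserted: no estimate, (3.6)–(3.9) ∕ (3.12)–(3.19) not used, Theorem 2
not asserted, no positivity of `ζ` assumed.  Counts unmoved (of record R444: typed 28∕28 · discharged 5∕28); nothing continuum ∕ ℝ⁴ ∕ OS
∕ mass-gap ∕ Clay.  No `sorry`, no `axiom`, no `opaque`, no `instance`, no `notation`.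
-/

noncomputable section

open MeasureTheory
open scoped BigOperators

namespace Literature.MathematicalPhysics.QuantumFieldTheory.Balaban1983to89.Node00

open T4Continuum B14.Eq218Concrete T4AveragingDisintegration T4FiniteEpsInhabited
open B15DeterminingSets B14.Eq213DetSet B14.Eq216Concrete B14.Eq213MaximalDomains B15Eq112TorusCover B14DomainGeom
open B14.Sect3Decomp

/-! ## §1  Layer algebra of print over an `s`-cube family of the fine torus (every value a member of `unionsOfCubes P s`) -/

section LayerAlgebra

variable (P : Params) (s : ℕ)

open Classical in
/-- `hullD P s n X`: the union of the `s`-cubes of the torus partition lying within `n` layers of `X` — for `n = 0` print's `X̃`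
(*«we denote by Z̃_k the union of all LMR_{k+1}-cubes intersecting the region Z_k»*, p. 264), for `n ≥ 1` *«surrounded by n layers»* of
such cubes (p. 265; the cube of index `a` is within `n` layers of `X` iff its `n`-collar `cubeEnl P s a n` meets `X`).
[cite: Balaban1988Convergent, p.264–265; Balaban1987RG1, (2.10) p.257] -/
def hullD (n : ℕ) (X : Set (Site P 0)) : Set (Site P 0) :=
  ⋃ a ∈ (cubeIndices P s).filter (fun a => (cubeEnl P s a n ∩ X).Nonempty), cubeEnl P s a 0

/-- `innerD P s n Y = ((Yᶜ)^{∼n})ᶜ`: `Y` with `n` layers of `s`-cubes taken off (*«the domain obtained by taking off one layer of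
LMR_{k+1}-cubes»*, p. 268; [I] (2.10) `∼⁻ⁿ`, r11's reading `(B)^{∼−1} = ((Bᶜ)^∼)ᶜ`). [cite: Balaban1988Convergent, p.268; Balaban1987RG1, (2.10) p.257] -/
def innerD (n : ℕ) (Y : Set (Site P 0)) : Set (Site P 0) :=
  (hullD P s n Yᶜ)ᶜ

open Classical in
/-- `fillD P s X`: the largest union of `s`-cubes of the torus partition contained in `X` (the typing guard by which a set expression of
print is read as a member of the class of unions of cubes). [cite: Balaban1988Convergent, (2.1) p.254 (bookkeeping)] -/
def fillD (X : Set (Site P 0)) : Set (Site P 0) :=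
  ⋃ a ∈ (cubeIndices P s).filter (fun a => cubeEnl P s a 0 ⊆ X), cubeEnl P s a 0

open Classical in
/-- `hullD` values are unions of cubes of the family (members of def-R's `unionsOfCubes`). [cite: Balaban1988Convergent, (2.1) p.254 (bookkeeping)] -/
theorem hullD_mem_unionsOfCubes (n : ℕ) (X : Set (Site P 0)) : hullD P s n X ∈ unionsOfCubes P s :=
  ⟨(cubeIndices P s).filter (fun a => (cubeEnl P s a n ∩ X).Nonempty), Finset.filter_subset _ _, rfl⟩

open Classical in
/-- `fillD` values are unions of cubes of the family (members of def-R's `unionsOfCubes`). [cite: Balaban1988Convergent, (2.1) p.254 (bookkeeping)] -/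
theorem fillD_mem_unionsOfCubes (X : Set (Site P 0)) : fillD P s X ∈ unionsOfCubes P s :=
  ⟨(cubeIndices P s).filter (fun a => cubeEnl P s a 0 ⊆ X), Finset.filter_subset _ _, rfl⟩

/-- `fillD P s X ⊆ X`. [cite: Balaban1988Convergent, (2.1) p.254 (bookkeeping)] -/
theorem fillD_subset (X : Set (Site P 0)) : fillD P s X ⊆ X := by
  classical
  intro x hx
  simp only [fillD, Set.mem_iUnion] at hx
  obtain ⟨a, ha, hx⟩ := hx
  exact (Finset.mem_filter.1 ha).2 hx

/-- A cube of the family is nonempty: its lower corner `s·a` lies in it (membership in `cubeIndices P s` forces `s ≥ 1`, the empty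
index family being the `s = 0` junk corner of def-R's `chiOfRecord_of_M₂_eq_zero`). [cite: Balaban1988Convergent, (2.17) p.257 (bookkeeping)] -/
theorem cubeEnl_zero_nonempty {a : Pt P.d} (ha : a ∈ cubeIndices P s) : (cubeEnl P s a 0).Nonempty := by
  have hs : s ≠ 0 := by
    rintro rfl
    haveI : Nonempty (Fin P.d) := ⟨⟨0, P.hd⟩⟩
    simp [cubeIndices] at ha
  refine ⟨cover P (fun i => (s : ℤ) * a i), Set.mem_image_of_mem _ ?_⟩
  intro i
  have h1 : (1 : ℤ) ≤ (s : ℤ) := by exact_mod_cast Nat.one_le_iff_ne_zero.mpr hs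
  constructor
  · simp
  · push_cast; linarith

end LayerAlgebra

/-! ## §2  The two cube families of step k+1 and the label type `(P,Q,R,S)_{k+1}` -/

section Families

variable (F : T4Family) (ν : Stage7Numerics) (M : ℕ)

/-- The side (fine sites) of the 𝐃_{k+1}-cubes of record: def-R's `dCubeSide … (k+1)` (*«LMR_{k+1}-cubes … of the lattice T_η»*
p. 264 = the `MR_{k+1}`-cubes of `T_{L^{−(k+1)}}` of the class 𝐃_{k+1}, (2.1)). [cite: Balaban1988Convergent, (2.1) p.254, p.264] -/
def sideD (p : B12.RunParams) (g : ℕ → ℝ) (k : ℕ) : ℕ :=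
  dCubeSide (F.P p.K).L M (RkOfRecord (F.P p.K).L ν.r (g (k + 1))) (k + 1)

/-- The side (fine sites) of the χ_{k+1}-cubes: def-R's `cubeSide … (k+1)` (*«cubes of the size L²M₂R_{k+1}»* of `T_η`, (3.2) p. 265
= the (2.17) cubes one level up). [cite: Balaban1988Convergent, (3.2) p.265, (2.17) p.257] -/
def sideχ (p : B12.RunParams) (g : ℕ → ℝ) (k : ℕ) : ℕ :=
  cubeSide (F.P p.K).L ν.M₂ (RkOfRecord (F.P p.K).L ν.r (g (k + 1))) (k + 1)

/-- The index type of the χ_{k+1}-cubes `□′` of (3.2) (def-R's `cubeIndices` at the step-(k+1) side). [cite: Balaban1988Convergent, (3.2) p.265] -/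
abbrev Iχ (p : B12.RunParams) (g : ℕ → ℝ) (k : ℕ) : Type :=
  ↥(cubeIndices (F.P p.K) (sideχ F ν p g k))

/-- The point set of the χ_{k+1}-cube `□′` on the fine torus. [cite: Balaban1988Convergent, (3.2) p.265] -/
def cubeχ (p : B12.RunParams) (g : ℕ → ℝ) (k : ℕ) (c : Iχ F ν p g k) : Set (Site (F.P p.K) 0) :=
  cubeEnl (F.P p.K) (sideχ F ν p g k) c 0

/-- The point set of a union of χ_{k+1}-cubes. [cite: Balaban1988Convergent, (3.2) p.265 (bookkeeping)] -/
def cubesχ (p : B12.RunParams) (g : ℕ → ℝ) (k : ℕ) (X : Finset (Iχ F ν p g k)) : Set (Site (F.P p.K) 0) :=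
  ⋃ c ∈ X, cubeχ F ν p g k c

/-- **THE LABELS** `t = (P_{k+1}, Q_{k+1}, R_{k+1}, S_{k+1})`: the summation variables introduced at step k+1 by (3.2), (3.3), (3.16),
(3.20)∕(3.21) — quadruples of finite sets of χ_{k+1}-cube indices (ONE finite type per `(p, g, k)`). [cite: Balaban1988Convergent, (3.2)–(3.3) p.265, (3.16) p.268, (3.20)–(3.21) p.269] -/
abbrev LbOfRecord (p : B12.RunParams) (g : ℕ → ℝ) (k : ℕ) : Type :=
  Finset (Iχ F ν p g k) × Finset (Iχ F ν p g k) × (Finset (Iχ F ν p g k) × Finset (Iχ F ν p g k))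

end Families

/-! ## §3  The index map (3.5) ∕ (3.20): `t ↦ (Ω_{k+1}(t), Λ_{k+1}(t))` appended to the old sequence -/

section IndexMap

variable (F : T4Family) (ν : Stage7Numerics) (M : ℕ) (p : B12.RunParams) (g : ℕ → ℝ) (k : ℕ)

/-- The large-field region of the term, `Z_k = Λ_kᶜ` ((2.3) p. 255; p. 264 *«The term has a large field region Z_k = Λ_kᶜ»*); at `k = 0`
there is none (the one-term representation of `ρ₀`). [cite: Balaban1988Convergent, (2.3) p.255, p.264] -/
def Zreg (s : SeqOfRecord F ν M g p.K k) : Set (Site (F.P p.K) 0) :=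
  if 1 ≤ k then (s.Λ k)ᶜ else ∅

/-- `Z̃_k^{∼4}`: the union of the LMR_{k+1}-cubes intersecting `Z_k`, surrounded by four layers (p. 264–265).
[cite: Balaban1988Convergent, p.264–265] -/
def Ztilde4 (s : SeqOfRecord F ν M g p.K k) : Set (Site (F.P p.K) 0) :=
  hullD (F.P p.K) (sideD F ν M p g k) 4 (hullD (F.P p.K) (sideD F ν M p g k) 0 (Zreg F ν M p g k s))

/-- The (3.2) window `(Z̃_k^{∼4})ᶜ` (*«the following decomposition of unity for the domain (Z̃_k^{∼4})ᶜ»*, p. 265).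
[cite: Balaban1988Convergent, (3.2) p.265] -/
def W32 (s : SeqOfRecord F ν M g p.K k) : Set (Site (F.P p.K) 0) :=
  (Ztilde4 F ν M p g k s)ᶜ

/-- The (3.2) summation range: the χ_{k+1}-cubes inside `(Z̃_k^{∼4})ᶜ` (*«domains P_{k+1} ⊂ (Z̃_k^{∼4})ᶜ, which are unions of
L²M₂R_{k+1}-cubes»*). [cite: Balaban1988Convergent, (3.2) p.265] -/
def cubes32 (s : SeqOfRecord F ν M g p.K k) : Finset (Iχ F ν p g k) :=
  cubesIn (cubeχ F ν p g k) (W32 F ν M p g k s)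

/-- `B^{k+1}(P¹_{k+1}) = ((P′_{k+1} ∪ Z̃_k^{∼4})^{∼1})ᶜ = (P′^∼_{k+1})ᶜ ∩ (Z̃_k^{∼5})ᶜ`, `P′_{k+1} = P̃_{k+1}` (p. 265).
[cite: Balaban1988Convergent, p.265] -/
def Bdom (s : SeqOfRecord F ν M g p.K k) (Pl : Finset (Iχ F ν p g k)) : Set (Site (F.P p.K) 0) :=
  (hullD (F.P p.K) (sideD F ν M p g k) 1
      (hullD (F.P p.K) (sideD F ν M p g k) 0 (cubesχ F ν p g k Pl) ∪ Ztilde4 F ν M p g k s))ᶜ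

/-- The (3.3) summation range: the χ_{k+1}-cubes inside `(B^{k+1}(P¹_{k+1}))^{∼−1}` (*«subdomains Q_{k+1} ⊂ (B^{k+1}(P¹_{k+1}))^{∼−1},
which are unions of L²M₂R_{k+1}-cubes»*). [cite: Balaban1988Convergent, (3.3) p.265] -/
def qcubes (s : SeqOfRecord F ν M g p.K k) (Pl : Finset (Iχ F ν p g k)) : Finset (Iχ F ν p g k) :=
  cubesIn (cubeχ F ν p g k) (innerD (F.P p.K) (sideD F ν M p g k) 1 (Bdom F ν M p g k s Pl))

/-- **(3.5)**: `Ω_{k+1} = ((Q̃_{k+1} ∪ ((B^{k+1}(P¹_{k+1}))ᶜ)^∼)^{∼2})ᶜ`. [cite: Balaban1988Convergent, (3.5) p.265] -/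
def Omega0 (s : SeqOfRecord F ν M g p.K k) (Pl Ql : Finset (Iχ F ν p g k)) : Set (Site (F.P p.K) 0) :=
  (hullD (F.P p.K) (sideD F ν M p g k) 2
      (hullD (F.P p.K) (sideD F ν M p g k) 0 (cubesχ F ν p g k Ql) ∪
        hullD (F.P p.K) (sideD F ν M p g k) 0 (Bdom F ν M p g k s Pl)ᶜ))ᶜ

/-- The admissibility window for `Ω_{k+1}`: `Λ_k` ((2.1): `Ω_{k+1} ⊂ Λ_k`; no condition at `k = 0`).
[cite: Balaban1988Convergent, (2.1) p.254] -/
def LamPrev (s : SeqOfRecord F ν M g p.K k) : Set (Site (F.P p.K) 0) :=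
  if 1 ≤ k then s.Λ k else Set.univ

/-- The TYPING GUARD `Λ_k ∩ (Z̃_k^{∼4})ᶜ ∩ (∪P_{k+1})ᶜ` (a no-op in print, where `Ω_{k+1} ⊆ B^{k+1}(P¹) ⊆ (Z̃^{∼5})ᶜ ∩ (P′^∼)ᶜ ⊆ Λ_k` by
nesting of the partitions). [cite: Balaban1988Convergent, (3.5) p.265 (typing guard)] -/
def guardΩ (s : SeqOfRecord F ν M g p.K k) (Pl : Finset (Iχ F ν p g k)) : Set (Site (F.P p.K) 0) :=
  LamPrev F ν M p g k s ∩ W32 F ν M p g k s ∩ (cubesχ F ν p g k Pl)ᶜ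

/-- **`Ω_{k+1}(t)` OF RECORD**: (3.5), guarded and filled with 𝐃_{k+1}-cubes. [cite: Balaban1988Convergent, (3.5) p.265] -/
def OmegaOfLabel (s : SeqOfRecord F ν M g p.K k) (t : LbOfRecord F ν p g k) : Set (Site (F.P p.K) 0) :=
  fillD (F.P p.K) (sideD F ν M p g k) (Omega0 F ν M p g k s t.1 t.2.1 ∩ guardΩ F ν M p g k s t.1)

/-- The (3.16) summation range: the χ_{k+1}-cubes inside `Ω^{∼−1}_{k+1}` (*«subdomains of Ω^{∼−1}_{k+1}, which are unions of
L²M₂R_{k+1}-cubes»*, p. 268). [cite: Balaban1988Convergent, (3.16) p.268] -/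
def rcubes (s : SeqOfRecord F ν M g p.K k) (t : LbOfRecord F ν p g k) : Finset (Iχ F ν p g k) :=
  cubesIn (cubeχ F ν p g k) (innerD (F.P p.K) (sideD F ν M p g k) 1 (OmegaOfLabel F ν M p g k s t))

/-- **(3.20)** before the guard: `Λ_{k+1} = (((Ω_{k+1}ᶜ)^∼ ∪ R̃_{k+1})^{∼1})ᶜ`. [cite: Balaban1988Convergent, (3.20) p.269] -/
def Lambda0 (s : SeqOfRecord F ν M g p.K k) (t : LbOfRecord F ν p g k) : Set (Site (F.P p.K) 0) :=
  (hullD (F.P p.K) (sideD F ν M p g k) 1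
      (hullD (F.P p.K) (sideD F ν M p g k) 0 (OmegaOfLabel F ν M p g k s t)ᶜ ∪
        hullD (F.P p.K) (sideD F ν M p g k) 0 (cubesχ F ν p g k t.2.2.1)))ᶜ

/-- **`Λ_{k+1}(t)` OF RECORD**: (3.20), intersected with `Ω_{k+1}(t)` and filled with 𝐃_{k+1}-cubes (the p. 269 parallelepiped
modification is NOT applied — located simplification). [cite: Balaban1988Convergent, (3.20) p.269] -/
def LambdaOfLabel (s : SeqOfRecord F ν M g p.K k) (t : LbOfRecord F ν p g k) : Set (Site (F.P p.K) 0) :=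
  fillD (F.P p.K) (sideD F ν M p g k) (Lambda0 F ν M p g k s t ∩ OmegaOfLabel F ν M p g k s t)

/-- `Ω_{k+1}(t)` lies in the guard, in particular in `Λ_k ∩ (Z̃_k^{∼4})ᶜ ∩ (∪P)ᶜ`. [cite: Balaban1988Convergent, (2.1) p.254, (3.5) p.265 (bookkeeping)] -/
theorem OmegaOfLabel_subset_guard (s : SeqOfRecord F ν M g p.K k) (t : LbOfRecord F ν p g k) :
    OmegaOfLabel F ν M p g k s t ⊆ guardΩ F ν M p g k s t.1 :=
  (fillD_subset _ _ _).trans Set.inter_subset_right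

/-- `Λ_{k+1}(t) ⊆ Ω_{k+1}(t)` ((2.1)). [cite: Balaban1988Convergent, (2.1) p.254] -/
theorem LambdaOfLabel_subset (s : SeqOfRecord F ν M g p.K k) (t : LbOfRecord F ν p g k) :
    LambdaOfLabel F ν M p g k s t ⊆ OmegaOfLabel F ν M p g k s t :=
  (fillD_subset _ _ _).trans Set.inter_subset_right

/-- `Ω_{k+1}(t) ⊆ Λ_k` for `k ≥ 1` ((2.1)). [cite: Balaban1988Convergent, (2.1) p.254] -/
theorem OmegaOfLabel_subset_Λ (s : SeqOfRecord F ν M g p.K k) (t : LbOfRecord F ν p g k) (h1 : 1 ≤ k) :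
    OmegaOfLabel F ν M p g k s t ⊆ s.Λ k := by
  refine (OmegaOfLabel_subset_guard F ν M p g k s t).trans ?_
  intro x hx
  have hx' := hx.1.1
  simp only [LamPrev, if_pos h1] at hx'
  exact hx'

/-- **THE NEW ADMISSIBLE PAIR** `(Ω_{k+1}(t), Λ_{k+1}(t))` after `s` (n22-b's `Seq.ExtPair`): both in 𝐃_{k+1} of record,
`Λ_{k+1} ⊆ Ω_{k+1} ⊆ Λ_k`. [cite: Balaban1988Convergent, (2.1) p.254, (3.5) p.265, (3.20) p.269] -/
def extPairOfLabel (s : SeqOfRecord F ν M g p.K k) (t : LbOfRecord F ν p g k) :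
    Seq.ExtPair (DOfRecord F ν M g p.K) k s :=
  ⟨(OmegaOfLabel F ν M p g k s t, LambdaOfLabel F ν M p g k s t),
    fillD_mem_unionsOfCubes _ _ _, fillD_mem_unionsOfCubes _ _ _, LambdaOfLabel_subset F ν M p g k s t,
    OmegaOfLabel_subset_Λ F ν M p g k s t⟩

/-- **THE INDEX MAP OF RECORD** `σ s t = (Ω₁,…,Ω_k,Ω_{k+1}(t); Λ₁,…,Λ_k,Λ_{k+1}(t))` (n22-b's `Seq.snoc`).
[cite: Balaban1988Convergent, (3.5) p.265, (3.20) p.269, §3 p.267, p.270] -/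
def σOfRecord (s : SeqOfRecord F ν M g p.K k) (t : LbOfRecord F ν p g k) : SeqOfRecord F ν M g p.K (k + 1) :=
  s.snoc (extPairOfLabel F ν M p g k s t)

/-- (O1): dropping the appended pair returns the old sequence. [cite: Balaban1988Convergent, (2.1) p.254 (bookkeeping)] -/
@[simp] theorem init_σOfRecord (s : SeqOfRecord F ν M g p.K k) (t : LbOfRecord F ν p g k) :
    (σOfRecord F ν M p g k s t).init = s :=
  Seq.init_snoc _ _

/-- The appended sequence has `Ω_{k+1} = Ω_{k+1}(t)`. [cite: Balaban1988Convergent, (3.5) p.265 (bookkeeping)] -/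
@[simp] theorem σOfRecord_Ω_succ (s : SeqOfRecord F ν M g p.K k) (t : LbOfRecord F ν p g k) :
    (σOfRecord F ν M p g k s t).Ω (k + 1) = OmegaOfLabel F ν M p g k s t :=
  Seq.snoc_Ω_succ _ _

/-- The appended sequence has `Λ_{k+1} = Λ_{k+1}(t)`. [cite: Balaban1988Convergent, (3.20) p.269 (bookkeeping)] -/
@[simp] theorem σOfRecord_Λ_succ (s : SeqOfRecord F ν M g p.K k) (t : LbOfRecord F ν p g k) :
    (σOfRecord F ν M p g k s t).Λ (k + 1) = LambdaOfLabel F ν M p g k s t :=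
  Seq.snoc_Λ_succ _ _

/-- The χ_{k+1}-cubes inside `Ω_{k+1}(t)` belong to the (3.2) range and avoid `P_{k+1}` (from the guard; cubes are nonempty).
[cite: Balaban1988Convergent, (3.2) p.265, p.267 (bookkeeping)] -/
theorem cubesIn_OmegaOfLabel_subset (s : SeqOfRecord F ν M g p.K k) (t : LbOfRecord F ν p g k) :
    cubesIn (cubeχ F ν p g k) (OmegaOfLabel F ν M p g k s t) ⊆ cubes32 F ν M p g k s \ t.1 := by
  classical
  intro c hc
  rw [mem_cubesIn] at hc
  have hg := hc.trans (OmegaOfLabel_subset_guard F ν M p g k s t)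
  rw [Finset.mem_sdiff]
  constructor
  · rw [cubes32, mem_cubesIn]
    exact hg.trans (Set.inter_subset_left.trans Set.inter_subset_right)
  · intro hP
    have hsub : cubeχ F ν p g k c ⊆ cubesχ F ν p g k t.1 := by
      intro x hx
      simp only [cubesχ, Set.mem_iUnion]
      exact ⟨c, hP, hx⟩
    obtain ⟨x, hx⟩ := cubeEnl_zero_nonempty (F.P p.K) (sideχ F ν p g k) c.2
    exact (hg hx).2 (hsub hx)

end IndexMap

/-! ## §4  The (3.2)∕(3.3)∕(3.4) data of r11's `Sect3Data`, PINNED at the record -/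

section PinnedData

variable (F : T4Family) (N : ℕ) [NeZero N] (ν : Stage7Numerics) (M : ℕ) (p : B12.RunParams) (g : ℕ → ℝ) (k : ℕ)

/-- `δ_k = g_k A₁∕(A₀ p₀(g_k))` of (3.4) (`A₀ p₀(g) = A₀ (log g⁻²)^{p₀}` = `Setup.p0Profile`; `A₁` of [I] (1.16) a parameter).
[cite: Balaban1988Convergent, (3.4) p.265] -/
def deltaOfRecord (A₁ : ℝ) : ℝ :=
  g k * A₁ / p0Profile ν.A₀ ν.p₀ (g k)

/-- The ONE (3.2) factor of the χ_{k+1}-cube `□′` at the record: `χ({sup_{p⊂□′^∼}|U_{k+1,□′}(∂p) − 1| < ε_{k+1}(L⁻¹η)²})(V_{k+1})` with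
def-R's pins one level up ((2.16) `ukBox` on `□′^{∼4}` with the (2.12) datum `bgOfRecord`, plaquettes `p ⊂ □′^∼`, `ε_{k+1}` of
`epsOfRecord`) — by construction THE factor of `chiSeqOfRecord … (k+1)` (`chiSeqOfRecord_succ_σOfRecord`). [cite: Balaban1988Convergent, (3.2) p.265, (2.16)–(2.17) p.257] -/
def chiFactor (c : Iχ F ν p g k) (V' : GaugeField (F.P p.K) (k + 1) (SU N)) : ℝ :=
  chiSmall (plaqInside (cubeEnl (F.P p.K) (sideχ F ν p g k) c 1))
    (epsOfRecord ν g (k + 1) * (F.P p.K).eta (k + 1) ^ 2)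
    (ukBox (bgOfRecord (avOfRecord F N p.K) {U | PlaqSmall (ν.εreg * (F.P p.K).eta (k + 1) ^ 2) U}) ν.M₁
      (cubeEnl (F.P p.K) (sideχ F ν p g k) c 4) (k + 1) V')

/-- The (3.2) factor takes values in `{0,1}`: it is idempotent. [cite: Balaban1988Convergent, (3.2) p.265 (bookkeeping)] -/
theorem chiFactor_mul_self (c : Iχ F ν p g k) (V' : GaugeField (F.P p.K) (k + 1) (SU N)) :
    chiFactor F N ν p g k c V' * chiFactor F N ν p g k c V' = chiFactor F N ν p g k c V' := by
  unfold chiFactor chiSmall; split_ifs <;> norm_num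

/-- `0 ≤` the (3.2) factor. [cite: Balaban1988Convergent, (3.2) p.265 (bookkeeping)] -/
theorem chiFactor_nonneg (c : Iχ F ν p g k) (V' : GaugeField (F.P p.K) (k + 1) (SU N)) :
    0 ≤ chiFactor F N ν p g k c V' :=
  chiSmall_nonneg _ _ _

/-- The (3.2) factor is `≤ 1`. [cite: Balaban1988Convergent, (3.2) p.265 (bookkeeping)] -/
theorem chiFactor_le_one (c : Iχ F ν p g k) (V' : GaugeField (F.P p.K) (k + 1) (SU N)) :
    chiFactor F N ν p g k c V' ≤ 1 :=
  chiSmall_le_one _ _ _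

/-- **THE FRONT FACTOR ONE STEP UP**: `χ_{k+1}(Ω_{k+1})` of record on the appended sequence is the product of the (3.2) factors over the
χ_{k+1}-cubes inside `Ω_{k+1}(t)` (p. 267: *«The other characteristic functions introduced above are localized in Ω_{k+1}, and are
equal to χ_{k+1}(Ω_{k+1})…»*). [cite: Balaban1988Convergent, (2.17)–(2.18) p.257, p.267] -/
theorem chiSeqOfRecord_succ_σOfRecord (s : SeqOfRecord F ν M g p.K k) (t : LbOfRecord F ν p g k)
    (V' : GaugeField (F.P p.K) (k + 1) (SU N)) :
    chiSeqOfRecord F N ν M g p.K (k + 1) (σOfRecord F ν M p g k s t) V' =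
      ∏ c ∈ cubesIn (cubeχ F ν p g k) (OmegaOfLabel F ν M p g k s t), chiFactor F N ν p g k c V' := by
  rw [chiSeqOfRecord, chi218_apply, σOfRecord_Ω_succ]
  rfl

open Classical in
/-- **THE (3.2)∕(3.3)∕(3.4) DATA PINNED AT THE RECORD** (a value of r11's `B14.Sect3Decomp.Sect3Data`, not an instance): cubes = the
χ_{k+1}-indices; `{p ⊂ □′^∼}`; `(□′^{∼2})^{(k)*}` = the level-`k` bonds with both ends in `□′^{∼2}` (r12's `embIter`);
`(B^{k+1}(P¹_{k+1}))^{∼−1}` as the family `inB`; `U_{k+1,□′}(V_{k+1})` = def-R's (2.16) `ukBox` one level up.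
[cite: Balaban1988Convergent, (3.2)–(3.4) p.265, (2.16) p.257] -/
def sect3DataOfRecord (s : SeqOfRecord F ν M g p.K k) : Sect3Data (F.P p.K) (SU N) k where
  Cube1 := Iχ F ν p g k
  plaqT c := plaqInside (cubeEnl (F.P p.K) (sideχ F ν p g k) c 1)
  bondsStar c := Finset.univ.filter (fun b : PBond (F.P p.K) k =>
    embIter k b.src ∈ cubeEnl (F.P p.K) (sideχ F ν p g k) c 2 ∧ embIter k b.tgt ∈ cubeEnl (F.P p.K) (sideχ F ν p g k) c 2)
  inB Pl := qcubes F ν M p g k s Pl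
  UkLoc c V' := ukBox (bgOfRecord (avOfRecord F N p.K) {U | PlaqSmall (ν.εreg * (F.P p.K).eta (k + 1) ^ 2) U}) ν.M₁
    (cubeEnl (F.P p.K) (sideχ F ν p g k) c 4) (k + 1) V'

/-- r11's `χ_{k+1}(X)` of (3.2) on the pinned data is the product of the (3.2) factors of record. [cite: Balaban1988Convergent, (3.2) p.265 (bookkeeping)] -/
theorem chiNext_sect3DataOfRecord (s : SeqOfRecord F ν M g p.K k) (X : Finset (Iχ F ν p g k))
    (V' : GaugeField (F.P p.K) (k + 1) (SU N)) :
    chiNext (sect3DataOfRecord F N ν M p g k s) (epsOfRecord ν g (k + 1)) X V' = ∏ c ∈ X, chiFactor F N ν p g k c V' :=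
  rfl

/-- r11's `(3.3)` range `inB P_{k+1}` on the pinned data is `qcubes`. [cite: Balaban1988Convergent, (3.3) p.265 (bookkeeping)] -/
theorem inB_sect3DataOfRecord (s : SeqOfRecord F ν M g p.K k) (Pl : Finset (Iχ F ν p g k)) :
    (sect3DataOfRecord F N ν M p g k s).inB Pl = qcubes F ν M p g k s Pl :=
  rfl

end PinnedData

/-! ## §5  The label weights: pinned (3.2)·(3.3) factors and the residual fluctuation factor `ζ_{k+1}(R,S)` -/

section Weights

variable (F : T4Family) (N : ℕ) [NeZero N] (ν : Stage7Numerics) (M : ℕ)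

/-- The type of the RESIDUAL fluctuation factor `ζ_{k+1}(R_{k+1}, S_{k+1})` of (3.16)·(3.20)·(3.21) per run ∕ couplings ∕ step ∕ old
sequence ∕ `(P,Q)` ∕ `(R,S)`, as a function of the old and new fields (its argument in print is the fluctuation field
`A_k = (1∕i) log[V_k (V^{(k)})⁻¹]`, `V^{(k)} = M^k(U_{k+1})` the sequence-dependent minimiser of (3.10) — `Claim310`, no body in the tree).
[cite: Balaban1988Convergent, (3.16) p.268, (3.20)–(3.21) p.269, (3.10)–(3.11) p.266] -/
abbrev ZetaOfRecord : Type :=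
  (p : B12.RunParams) → (g : ℕ → ℝ) → (k : ℕ) → SeqOfRecord F ν M g p.K k →
    Finset (Iχ F ν p g k) → Finset (Iχ F ν p g k) → Finset (Iχ F ν p g k) × Finset (Iχ F ν p g k) →
      GaugeField (F.P p.K) k (SU N) → GaugeField (F.P p.K) (k + 1) (SU N) → ℝ

/-- DISPLAYED LAW of the residual: the (3.16)·(3.20) decomposition resolves unity, `Σ_{(R,S)} ζ_{k+1}(R,S) = 1` (an instance of r11's
`B14.Eq316.eq316` for ANY fluctuation field; dischargeable when the minimiser of (3.10) has a body). [cite: Balaban1988Convergent, (3.16) p.268, (3.20)–(3.21) p.269] -/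
def IsZetaUnity (ζ : ZetaOfRecord F N ν M) : Prop :=
  ∀ (p : B12.RunParams) (g : ℕ → ℝ) (k : ℕ) (s : SeqOfRecord F ν M g p.K k) (Pl Ql : Finset (Iχ F ν p g k))
    (U : GaugeField (F.P p.K) k (SU N)) (V' : GaugeField (F.P p.K) (k + 1) (SU N)),
    ∑ RS, ζ p g k s Pl Ql RS U V' = 1

/-- DISPLAYED LAW of the residual: `Σ_{(R,S)} |ζ_{k+1}(R,S)| ≤ 1` (print: mutually exclusive `{0,1}`-products).
[cite: Balaban1988Convergent, (3.16) p.268, (3.21) p.269 (bookkeeping)] -/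
def IsZetaAbsLeOne (ζ : ZetaOfRecord F N ν M) : Prop :=
  ∀ (p : B12.RunParams) (g : ℕ → ℝ) (k : ℕ) (s : SeqOfRecord F ν M g p.K k) (Pl Ql : Finset (Iχ F ν p g k))
    (U : GaugeField (F.P p.K) k (SU N)) (V' : GaugeField (F.P p.K) (k + 1) (SU N)),
    ∑ RS, |ζ p g k s Pl Ql RS U V'| ≤ 1

variable (p : B12.RunParams) (g : ℕ → ℝ) (k : ℕ)

/-- The (3.2) label weight of `P_{k+1}`: `[P ⊆ (3.2)-range] · χ_{k+1}(Pᶜ_{k+1}) χᶜ_{k+1}(P_{k+1})` (r11's `chiNext`∕`chiNextc` on the pinned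
data; `Pᶜ` relative to the (3.2) range). [cite: Balaban1988Convergent, (3.2) p.265] -/
def aWeight (s : SeqOfRecord F ν M g p.K k) (Pl : Finset (Iχ F ν p g k)) (V' : GaugeField (F.P p.K) (k + 1) (SU N)) : ℝ :=
  if Pl ⊆ cubes32 F ν M p g k s then
    chiNext (sect3DataOfRecord F N ν M p g k s) (epsOfRecord ν g (k + 1))
        (cubes32 F ν M p g k s \ Pl : Finset (Iχ F ν p g k)) V' *
      chiNextc (sect3DataOfRecord F N ν M p g k s) (epsOfRecord ν g (k + 1)) Pl V'
  else 0

/-- The (3.3) label weight of `Q_{k+1}` given `P_{k+1}`: `[Q ⊆ (3.3)-range] · χ′_k(Qᶜ_{k+1}) χ′ᶜ_k(Q_{k+1})` (r11's `chiPrime`∕`chiPrimec` on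
the pinned data with the averaging of record and `2δ_k`; `Qᶜ` relative to `(B^{k+1}(P¹_{k+1}))^{∼−1}`). [cite: Balaban1988Convergent, (3.3)–(3.4) p.265] -/
def bWeight (A₁ : ℝ) (s : SeqOfRecord F ν M g p.K k) (Pl Ql : Finset (Iχ F ν p g k))
    (U : GaugeField (F.P p.K) k (SU N)) (V' : GaugeField (F.P p.K) (k + 1) (SU N)) : ℝ :=
  if Ql ⊆ qcubes F ν M p g k s Pl then
    chiPrime (sect3DataOfRecord F N ν M p g k s) (avOfRecord F N p.K) (2 * deltaOfRecord ν g k A₁)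
        (qcubes F ν M p g k s Pl \ Ql : Finset (Iχ F ν p g k)) U V' *
      chiPrimec (sect3DataOfRecord F N ν M p g k s) (avOfRecord F N p.K) (2 * deltaOfRecord ν g k A₁) Ql U V'
  else 0

/-- **THE LABEL WEIGHTS OF RECORD** `ω s t (U, V') = a(P)(V') · b(P,Q)(U,V') · ζ(R,S)(U,V')` — the (3.2)·(3.3) factors pinned, the
(3.16)·(3.20)·(3.21) factor residual; the front factor `χ_{k+1}(Ω_{k+1}(t))` is NOT divided out (`front_absorb`).
[cite: Balaban1988Convergent, (3.2)–(3.5) p.265, (3.16) p.268, (3.20)–(3.21) p.269] -/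
def ωOfRecord (A₁ : ℝ) (ζ : ZetaOfRecord F N ν M) (s : SeqOfRecord F ν M g p.K k) (t : LbOfRecord F ν p g k)
    (U : GaugeField (F.P p.K) k (SU N)) (V' : GaugeField (F.P p.K) (k + 1) (SU N)) : ℝ :=
  aWeight F N ν M p g k s t.1 V' * bWeight F N ν M p g k A₁ s t.1 t.2.1 U V' * ζ p g k s t.1 t.2.1 t.2.2 U V'

/-! ### The two pinned decompositions resolve unity (r11's `eq32`, `eq33`), and their sizes -/

/-- A sum over all finite subsets with the indicator of `· ⊆ A` is the sum over the powerset of `A`. [folklore] -/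
private theorem sum_ite_subset_eq_sum_powerset {ι : Type*} [Fintype ι] [DecidableEq ι] (A : Finset ι) (f : Finset ι → ℝ) :
    (∑ X : Finset ι, if X ⊆ A then f X else 0) = ∑ X ∈ A.powerset, f X := by
  rw [← Finset.sum_filter]
  refine Finset.sum_congr ?_ (fun _ _ => rfl)
  ext X
  simp

/-- `Σ_{P_{k+1}} a(P_{k+1}) = 1` — (3.2), r11's `eq32` on the pinned data. [cite: Balaban1988Convergent, (3.2) p.265] -/
theorem sum_aWeight (s : SeqOfRecord F ν M g p.K k) (V' : GaugeField (F.P p.K) (k + 1) (SU N)) :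
    ∑ Pl, aWeight F N ν M p g k s Pl V' = 1 := by
  classical
  unfold aWeight
  rw [sum_ite_subset_eq_sum_powerset]
  exact eq32 (sect3DataOfRecord F N ν M p g k s) (epsOfRecord ν g (k + 1)) (cubes32 F ν M p g k s) V'

/-- `Σ_{Q_{k+1}} b(P_{k+1}, Q_{k+1}) = 1` — (3.3), r11's `eq33` on the pinned data. [cite: Balaban1988Convergent, (3.3) p.265] -/
theorem sum_bWeight (A₁ : ℝ) (s : SeqOfRecord F ν M g p.K k) (Pl : Finset (Iχ F ν p g k))
    (U : GaugeField (F.P p.K) k (SU N)) (V' : GaugeField (F.P p.K) (k + 1) (SU N)) :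
    ∑ Ql, bWeight F N ν M p g k A₁ s Pl Ql U V' = 1 := by
  classical
  unfold bWeight
  rw [sum_ite_subset_eq_sum_powerset]
  exact eq33 (sect3DataOfRecord F N ν M p g k s) (avOfRecord F N p.K) (2 * deltaOfRecord ν g k A₁) Pl U V'

/-- `0 ≤ a(P)`. [cite: Balaban1988Convergent, (3.2) p.265 (bookkeeping)] -/
theorem aWeight_nonneg (s : SeqOfRecord F ν M g p.K k) (Pl : Finset (Iχ F ν p g k))
    (V' : GaugeField (F.P p.K) (k + 1) (SU N)) : 0 ≤ aWeight F N ν M p g k s Pl V' := by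
  classical
  unfold aWeight
  split_ifs
  · refine mul_nonneg ?_ ?_
    · rw [chiNext_sect3DataOfRecord]
      exact Finset.prod_nonneg fun c _ => chiFactor_nonneg F N ν p g k c V'
    · unfold chiNextc
      exact Finset.prod_nonneg fun c _ => sub_nonneg.2 (chiFactor_le_one F N ν p g k c V')
  · exact le_rfl

/-- `0 ≤ b(P, Q)`. [cite: Balaban1988Convergent, (3.3) p.265 (bookkeeping)] -/
theorem bWeight_nonneg (A₁ : ℝ) (s : SeqOfRecord F ν M g p.K k) (Pl Ql : Finset (Iχ F ν p g k))
    (U : GaugeField (F.P p.K) k (SU N)) (V' : GaugeField (F.P p.K) (k + 1) (SU N)) :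
    0 ≤ bWeight F N ν M p g k A₁ s Pl Ql U V' := by
  classical
  unfold bWeight chiPrime chiPrimec
  split_ifs
  · exact mul_nonneg (Finset.prod_nonneg fun c _ => by split_ifs <;> norm_num)
      (Finset.prod_nonneg fun c _ => by split_ifs <;> norm_num)
  · exact le_rfl

/-- Absorbing a sub-product of idempotent factors: `(Π_X f)(Π_Y f) = Π_Y f` for `X ⊆ Y`, `f·f = f`. [folklore] -/
private theorem prod_mul_prod_of_subset_of_mul_self {ι : Type*} {X Y : Finset ι} (h : X ⊆ Y) (f : ι → ℝ)
    (hf : ∀ c, f c * f c = f c) : (∏ c ∈ X, f c) * ∏ c ∈ Y, f c = ∏ c ∈ Y, f c := by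
  classical
  rw [← Finset.prod_sdiff h, mul_comm (∏ c ∈ Y \ X, f c), ← mul_assoc, ← Finset.prod_mul_distrib,
    Finset.prod_congr rfl fun c _ => hf c]

/-- **FRONT-FACTOR ABSORPTION**: `χ_{k+1}(Ω_{k+1}(t))(V') · a(P_{k+1})(V') = a(P_{k+1})(V')` — the χ_{k+1}-cubes inside `Ω_{k+1}(t)` are
(3.2)-cubes outside `P_{k+1}` and the factors are idempotent. [cite: Balaban1988Convergent, (3.2) p.265, p.267] -/
theorem front_absorb (s : SeqOfRecord F ν M g p.K k) (t : LbOfRecord F ν p g k)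
    (V' : GaugeField (F.P p.K) (k + 1) (SU N)) :
    chiSeqOfRecord F N ν M g p.K (k + 1) (σOfRecord F ν M p g k s t) V' * aWeight F N ν M p g k s t.1 V' =
      aWeight F N ν M p g k s t.1 V' := by
  by_cases hP : t.1 ⊆ cubes32 F ν M p g k s
  · rw [aWeight, if_pos hP, chiSeqOfRecord_succ_σOfRecord, chiNext_sect3DataOfRecord, ← mul_assoc]
    congr 1
    exact prod_mul_prod_of_subset_of_mul_self (cubesIn_OmegaOfLabel_subset F ν M p g k s t)
      (fun c => chiFactor F N ν p g k c V') (fun c => chiFactor_mul_self F N ν p g k c V')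
  · rw [aWeight, if_neg hP, mul_zero]

/-! ### (O2), (O3) -/

/-- **(O2) LABEL-LEVEL UNITY, POINTWISE**: `Σ_t χ_{k+1}(Ω_{k+1}(t))(V') · ω s t (U, V') = 1` for all `U, V'` — (3.2) ∘ (3.3) ∘ the
ζ-law; in particular FILE 2's graph-side, `χ_k`-weighted hypothesis of `isStepUnity_stepWeightsOfResum`. [cite: Balaban1988Convergent, (3.2)–(3.5) p.265, (3.16) p.268, (3.20)–(3.21) p.269, §3 p.267] -/
theorem labelUnity_ωOfRecord (A₁ : ℝ) {ζ : ZetaOfRecord F N ν M} (hζ : IsZetaUnity F N ν M ζ)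
    (s : SeqOfRecord F ν M g p.K k) (U : GaugeField (F.P p.K) k (SU N)) (V' : GaugeField (F.P p.K) (k + 1) (SU N)) :
    ∑ t : LbOfRecord F ν p g k,
        chiSeqOfRecord F N ν M g p.K (k + 1) (σOfRecord F ν M p g k s t) V' * ωOfRecord F N ν M p g k A₁ ζ s t U V' = 1 := by
  have key : ∀ t : LbOfRecord F ν p g k,
      chiSeqOfRecord F N ν M g p.K (k + 1) (σOfRecord F ν M p g k s t) V' * ωOfRecord F N ν M p g k A₁ ζ s t U V' =
        aWeight F N ν M p g k s t.1 V' * (bWeight F N ν M p g k A₁ s t.1 t.2.1 U V' * ζ p g k s t.1 t.2.1 t.2.2 U V') := by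
    intro t
    rw [ωOfRecord, ← mul_assoc, ← mul_assoc, front_absorb, mul_assoc]
  have hz : ∀ Pl Ql : Finset (Iχ F ν p g k), ∑ R, ∑ S, ζ p g k s Pl Ql (R, S) U V' = 1 := fun Pl Ql => by
    rw [← hζ p g k s Pl Ql U V', Fintype.sum_prod_type]
  calc ∑ t : LbOfRecord F ν p g k,
        chiSeqOfRecord F N ν M g p.K (k + 1) (σOfRecord F ν M p g k s t) V' * ωOfRecord F N ν M p g k A₁ ζ s t U V'
      = ∑ t : LbOfRecord F ν p g k,
          aWeight F N ν M p g k s t.1 V' * (bWeight F N ν M p g k A₁ s t.1 t.2.1 U V' * ζ p g k s t.1 t.2.1 t.2.2 U V') :=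
        Finset.sum_congr rfl fun t _ => key t
    _ = ∑ Pl, ∑ Ql, ∑ R, ∑ S, aWeight F N ν M p g k s Pl V' *
          (bWeight F N ν M p g k A₁ s Pl Ql U V' * ζ p g k s Pl Ql (R, S) U V') := by
        simp only [Fintype.sum_prod_type]
    _ = ∑ Pl, aWeight F N ν M p g k s Pl V' * ∑ Ql, bWeight F N ν M p g k A₁ s Pl Ql U V' *
          ∑ R, ∑ S, ζ p g k s Pl Ql (R, S) U V' := by
        simp only [Finset.mul_sum]
    _ = 1 := by
        simp only [hz, mul_one, sum_bWeight]
        exact sum_aWeight F N ν M p g k s V'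

/-- **(O3)** `Σ_t |ω s t (U, V')| ≤ 1`. [cite: Balaban1988Convergent, (3.2)–(3.3) p.265, (3.16) p.268 (bookkeeping)] -/
theorem sum_abs_ωOfRecord_le_one (A₁ : ℝ) {ζ : ZetaOfRecord F N ν M} (hζ : IsZetaAbsLeOne F N ν M ζ)
    (s : SeqOfRecord F ν M g p.K k) (U : GaugeField (F.P p.K) k (SU N)) (V' : GaugeField (F.P p.K) (k + 1) (SU N)) :
    ∑ t : LbOfRecord F ν p g k, |ωOfRecord F N ν M p g k A₁ ζ s t U V'| ≤ 1 := by
  have key : ∀ t : LbOfRecord F ν p g k, |ωOfRecord F N ν M p g k A₁ ζ s t U V'| =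
      aWeight F N ν M p g k s t.1 V' * (bWeight F N ν M p g k A₁ s t.1 t.2.1 U V' * |ζ p g k s t.1 t.2.1 t.2.2 U V'|) := by
    intro t
    rw [ωOfRecord, abs_mul, abs_mul, abs_of_nonneg (aWeight_nonneg F N ν M p g k s t.1 V'),
      abs_of_nonneg (bWeight_nonneg F N ν M p g k A₁ s t.1 t.2.1 U V'), mul_assoc]
  have hz : ∀ Pl Ql : Finset (Iχ F ν p g k), ∑ R, ∑ S, |ζ p g k s Pl Ql (R, S) U V'| ≤ 1 := fun Pl Ql => by
    have h := hζ p g k s Pl Ql U V'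
    rwa [Fintype.sum_prod_type] at h
  calc ∑ t : LbOfRecord F ν p g k, |ωOfRecord F N ν M p g k A₁ ζ s t U V'|
      = ∑ t : LbOfRecord F ν p g k,
          aWeight F N ν M p g k s t.1 V' * (bWeight F N ν M p g k A₁ s t.1 t.2.1 U V' * |ζ p g k s t.1 t.2.1 t.2.2 U V'|) :=
        Finset.sum_congr rfl fun t _ => key t
    _ = ∑ Pl, ∑ Ql, ∑ R, ∑ S, aWeight F N ν M p g k s Pl V' *
          (bWeight F N ν M p g k A₁ s Pl Ql U V' * |ζ p g k s Pl Ql (R, S) U V'|) := by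
        simp only [Fintype.sum_prod_type]
    _ = ∑ Pl, aWeight F N ν M p g k s Pl V' * ∑ Ql, bWeight F N ν M p g k A₁ s Pl Ql U V' *
          ∑ R, ∑ S, |ζ p g k s Pl Ql (R, S) U V'| := by
        simp only [Finset.mul_sum]
    _ ≤ ∑ Pl, aWeight F N ν M p g k s Pl V' * ∑ Ql, bWeight F N ν M p g k A₁ s Pl Ql U V' * 1 := by
        refine Finset.sum_le_sum fun Pl _ => mul_le_mul_of_nonneg_left ?_ (aWeight_nonneg F N ν M p g k s Pl V')
        exact Finset.sum_le_sum fun Ql _ =>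
          mul_le_mul_of_nonneg_left (hz Pl Ql) (bWeight_nonneg F N ν M p g k A₁ s Pl Ql U V')
    _ = 1 := by
        simp only [mul_one, sum_bWeight]
        exact sum_aWeight F N ν M p g k s V'

end Weights

/-! ## §7  The step weights OF RECORD and the T-step provisos they discharge -/

section OfRecord

variable (F : T4Family) (N : ℕ) [NeZero N] (ν : Stage7Numerics) (M : ℕ)

/-- **THE STEP WEIGHTS OF RECORD** `wOfRecord A₁ ζ`: FILE 2's `stepWeightsOfResum` at the labels `(P,Q,R,S)_{k+1}`, the index map
(3.5)∕(3.20) and the label weights of §5 — `w(s')(U,V') = Σ_{t : σ (init s') t = s'} ω (init s') t (U,V')`.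
[cite: Balaban1988Convergent, (3.2)–(3.5) p.265, (3.16) p.268, (3.20)–(3.21) p.269, §3 p.267, p.270] -/
def wOfRecord (A₁ : ℝ) (ζ : ZetaOfRecord F N ν M) : StepWeightsOfRecord F N ν M :=
  stepWeightsOfResum F N ν M (LbOfRecord F ν) (σOfRecord F ν M) (ωOfRecord F N ν M · · · A₁ ζ)

/-- Unfolding of `wOfRecord` at `(p, g, k)`. [cite: Balaban1988Convergent, §3 p.267 (bookkeeping)] -/
theorem wOfRecord_apply (A₁ : ℝ) (ζ : ZetaOfRecord F N ν M) (p : B12.RunParams) (g : ℕ → ℝ) (k : ℕ) :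
    wOfRecord F N ν M A₁ ζ p g k = resumWeights (σOfRecord F ν M p g k) (ωOfRecord F N ν M p g k A₁ ζ) := rfl

/-- **THE UNITY LAW OF THE STEP WEIGHTS OF RECORD** (FILE 1's `IsStepUnity`, the `unity` proviso of FILE 2's `TStepProvisos`), from the
label-level unity (O2) by FILE 2's `isStepUnity_stepWeightsOfResum`, modulo the displayed ζ-law. [cite: Balaban1988Convergent, (3.2)–(3.5) p.265, (3.6)–(3.9) pp.265–266, (3.16) p.268, (3.20) p.269] -/
theorem isStepUnity_wOfRecord (A₁ : ℝ) {ζ : ZetaOfRecord F N ν M} (hζ : IsZetaUnity F N ν M ζ)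
    (p : B12.RunParams) (g : ℕ → ℝ) (k : ℕ) :
    IsStepUnity (avOfRecord F N p.K k).avg (chiSeqOfRecord F N ν M g p.K k) (chiSeqOfRecord F N ν M g p.K (k + 1))
      (wOfRecord F N ν M A₁ ζ p g k) := by
  refine isStepUnity_stepWeightsOfResum F N ν M (LbOfRecord F ν) (σOfRecord F ν M) (ωOfRecord F N ν M · · · A₁ ζ) p g k
    (fun s t => init_σOfRecord F ν M p g k s t) (fun s U => ?_)
  rw [labelUnity_ωOfRecord F N ν M p g k A₁ hζ s U ((avOfRecord F N p.K k).avg U), mul_one]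

/-- **`|w| ≤ 1`** for the step weights of record (the `absW_le` proviso), modulo the displayed ζ-size law.
[cite: Balaban1988Convergent, (3.2)–(3.3) p.265 (bookkeeping)] -/
theorem abs_wOfRecord_le_one (A₁ : ℝ) {ζ : ZetaOfRecord F N ν M} (hζ : IsZetaAbsLeOne F N ν M ζ)
    (p : B12.RunParams) (g : ℕ → ℝ) (k : ℕ) (s' : SeqOfRecord F ν M g p.K (k + 1))
    (U : GaugeField (F.P p.K) k (SU N)) (V' : GaugeField (F.P p.K) (k + 1) (SU N)) :
    |wOfRecord F N ν M A₁ ζ p g k s' U V'| ≤ 1 :=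
  abs_resumWeights_le_one _ _ (fun s U V' => sum_abs_ωOfRecord_le_one F N ν M p g k A₁ hζ s U V') s' U V'

/-- **Joint measurability of the step weights of record** (the `measW` proviso) from the DISPLAYED joint measurability of the label
weights (O4) — not provable today: def-R's (2.12) solution map is a classical-choice minimiser without a measurable selection in the
tree. [cite: Balaban1988Convergent, (3.2)–(3.3) p.265 (bookkeeping)] -/
theorem measurable_wOfRecord (A₁ : ℝ) (ζ : ZetaOfRecord F N ν M) (p : B12.RunParams) (g : ℕ → ℝ) (k : ℕ)
    (hω : ∀ (s : SeqOfRecord F ν M g p.K k) (t : LbOfRecord F ν p g k),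
      Measurable (fun z : GaugeField (F.P p.K) (k + 1) (SU N) × GaugeField (F.P p.K) k (SU N) =>
        ωOfRecord F N ν M p g k A₁ ζ s t z.2 z.1))
    (s' : SeqOfRecord F ν M g p.K (k + 1)) :
    Measurable (fun z : GaugeField (F.P p.K) (k + 1) (SU N) × GaugeField (F.P p.K) k (SU N) =>
      wOfRecord F N ν M A₁ ζ p g k s' z.2 z.1) :=
  measurable_resumWeights _ _ hω s'

end OfRecord

end Literature.MathematicalPhysics.QuantumFieldTheory.Balaban1983to89.Node00

end
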